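import Summits.Ventures.LatticeQCDFlow.Exactness.IMHAnyStartReplicas
import Summits.Ventures.LatticeQCDFlow.Exactness.IMHHotStartPath
import HarnessLib

/-!
# The hot start, second order: bias `∈ r^{b+1}·(S_N/N)·[a − π f, c − π f]`, mean-square error within `r^{b+1}·D²` of
# the equilibrium run's, hot-started replicas `E(Ȳ − π f)² ≤ [(1 − r^{b+1})·MSE_π(N) + r^{b+1}·D²]/R + (1 − 1/R)·(D·r^{b+1}·S_N/N)²`

HONEST FRAMING: exact (Metropolis-corrected) sampling algorithms for lattice gauge theory;
figures of merit are autocorrelation/cost numbers at stated couplings and volumes; no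
continuum-physics claim.

Venture `LatticeQCDFlow` (cell pub-lqcd), topic `Exactness`; FANOUT row 30 (lean-1, GEN-35).  NEW WORK of the
cell, general state space.  `K = indepMH q w` (normalised weight `w` maximal at `x₀`, `A = 1/w(x₀)`, `r = 1 − A`,
`S_N = Σ_{t<N} r^t`); `a ≤ f ≤ c`, `D = max(π f − a, c − π f)`.  THE HOT START is the initial law `μ₀ = q` (a fresh
draw of the flow ∕ autoregressive proposal — the start of every replica in the many-chains protocol).  GEN-34:
`q = A·π + (1 − A)·q'`, `P_q∘θ_b⁻¹ = (1 − r^{b+1})·P_π + r^{b+1}·P_ν` (`Exactness/IMHHotStartPath`).  Here the "+1"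
is carried into this generation's second-order laws:
* §1 **`imh_chain_hotStart_exists_mixture`** — `P_q = A·P_π + (1 − A)·P_{q'}` for some probability law `q'`, every
  `w(x₀) ≥ 1`; **`imh_chain_integral_hotStart_eq`** — `E_q[F] − E_π[F] = (1 − A)·(E_{q'}[F] − E_π[F])`.
* §2 **`imh_chain_windowAverage_bias_hotStart_mem_Icc`** ∕ **`…_abs_le`** — `E_q[A_{N,b}] − π f ∈
  r^{b+1}·(S_N/N)·[a − π f, c − π f]`, `|…| ≤ D·r^{b+1}·S_N/N ≤ D·r^{b+1}·min(1, w(x₀)/N)`.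
* §3 **`imh_chain_windowMSE_hotStart_mem_Icc`** ∕ **`…_le_explicit`** — `E_q[(A_{N,b} − π f)²] − MSE_π(N) ∈
  [−r^{b+1}·MSE_π(N), r^{b+1}·(D² − MSE_π(N))]`, `≤ (2w(x₀) − 1)·Var_π f/N + r^{b+1}·D²`.
* §4 **`imh_replicas_hotStart_mse_le`** ∕ **`…_explicit`** — HOT-STARTED REPLICAS (pairwise independent, `b` discards,
  `N ≥ 1` kept, `R ≥ 1` runs): `E(Ȳ − π f)² ≤ [(1 − r^{b+1})·MSE_π(N) + r^{b+1}·D²]/R + (1 − 1/R)·(D·r^{b+1}·S_N/N)²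
  ≤ [(2w(x₀) − 1)·Var_π f/N + r^{b+1}·D²]/R + (1 − 1/R)·(D·r^{b+1}·min(1, w(x₀)/N))²`.
Reading (gauge files `Scaling/AutoregressiveGauge…HotStartMSE`): every law of `…AnyStartMSE` ∕ `…Replicas` holds for
runs started from a draw of the autoregressive proposal with `(1 − A)^{b+1}` in place of `(1 − A)^b`.
NOT CLAIMED: that the hot start beats a particular other start; the law of `q'`; any number for a concrete weight.
No `sorry`, no new definitions, nothing cited as a fact.
-/

noncomputable section

namespace Summit.Ventures.LatticeQCDFlow.Exactness

open MeasureTheory ProbabilityTheory Function Finset Summit.Ventures.LatticeQCDFlow.Scoring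
open scoped ENNReal

variable {Ω : Type*} [MeasurableSpace Ω] {q : Measure Ω} [IsProbabilityMeasure q] {w : Ω → ℝ}

/-! ## §1 The hot-started run is the exact mixture `A·P_π + (1 − A)·P_{q'}` for every `w(x₀) ≥ 1` -/

/-- **`P_q = A·P_π + (1 − A)·P_{q'}`** for some probability law `q'`, every `w(x₀) ≥ 1` (GEN-34's
`imh_chain_hotStart_eq_mixture` for `w(x₀) > 1`; at `w(x₀) = 1` the hot start is the target and `A = 1`). [ours] -/
theorem imh_chain_hotStart_exists_mixture [Fact (Measurable w)] (hw0 : ∀ y, 0 < w y) {x₀ : Ω}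
    (hmax : ∀ y, w y ≤ w x₀) [IsProbabilityMeasure (q.withDensity fun y => ENNReal.ofReal (w y))] :
    ∃ q' : Measure Ω, IsProbabilityMeasure q' ∧
      Kernel.trajMeasure (X := fun _ : ℕ => Ω) q
          (fun n : ℕ => (indepMH q w).comap (fun h : (i : ↥(Finset.Iic n)) → Ω => h ⟨n, Finset.mem_Iic.2 le_rfl⟩)
            (measurable_pi_apply _)) =
        ENNReal.ofReal (w x₀)⁻¹ •
            Kernel.trajMeasure (X := fun _ : ℕ => Ω) (q.withDensity fun y => ENNReal.ofReal (w y))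
              (fun n : ℕ => (indepMH q w).comap (fun h : (i : ↥(Finset.Iic n)) → Ω => h ⟨n, Finset.mem_Iic.2 le_rfl⟩)
                (measurable_pi_apply _)) +
          ENNReal.ofReal (1 - (w x₀)⁻¹) •
            Kernel.trajMeasure (X := fun _ : ℕ => Ω) q'
              (fun n : ℕ => (indepMH q w).comap (fun h : (i : ↥(Finset.Iic n)) → Ω => h ⟨n, Finset.mem_Iic.2 le_rfl⟩)
                (measurable_pi_apply _)) := by
  set π : Measure Ω := q.withDensity fun y => ENNReal.ofReal (w y) with hπ
  have hW : 1 ≤ w x₀ := one_le_of_mode (q := q) hmax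
  rcases hW.lt_or_eq with hlt | h1
  · exact imh_chain_hotStart_eq_mixture (q := q) hw0 hmax hlt
  · refine ⟨π, inferInstance, ?_⟩
    have hq1 : q = π := by
      have h := hotStart_ge_target (q := q) Fact.out hw0 hmax
      rw [← h1, inv_one, ENNReal.ofReal_one, one_smul] at h
      refine Measure.ext fun B hB => le_antisymm ?_ (Measure.le_iff'.1 h B)
      have hc : π Bᶜ ≤ q Bᶜ := Measure.le_iff'.1 h Bᶜ
      have hq : q B = 1 - q Bᶜ := by
        rw [← prob_add_prob_compl (μ := q) hB, ENNReal.add_sub_cancel_right (measure_ne_top _ _)]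
      have hp : π B = 1 - π Bᶜ := by
        rw [← prob_add_prob_compl (μ := π) hB, ENNReal.add_sub_cancel_right (measure_ne_top _ _)]
      rw [hq, hp]
      exact tsub_le_tsub_left hc 1
    have hinit := congrArg (fun μ : Measure Ω => Kernel.trajMeasure (X := fun _ : ℕ => Ω) μ
      (fun n : ℕ => (indepMH q w).comap (fun h : (i : ↥(Finset.Iic n)) → Ω => h ⟨n, Finset.mem_Iic.2 le_rfl⟩)
        (measurable_pi_apply _))) hq1
    rw [hinit, ← h1, inv_one, sub_self, ENNReal.ofReal_one, ENNReal.ofReal_zero, one_smul, zero_smul, add_zero]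

/-- **`E_q[F] − E_π[F] = (1 − A)·(E_{q'}[F] − E_π[F])`** for every bounded measurable path statistic `F`, with the
probability law `q'` of `imh_chain_hotStart_exists_mixture`. [ours] -/
theorem imh_chain_integral_hotStart_eq [Fact (Measurable w)] (hw0 : ∀ y, 0 < w y) {x₀ : Ω}
    (hmax : ∀ y, w y ≤ w x₀) [IsProbabilityMeasure (q.withDensity fun y => ENNReal.ofReal (w y))]
    {F : (ℕ → Ω) → ℝ} (hF : Measurable F) {C : ℝ} (hC : ∀ x, |F x| ≤ C) :
    ∃ q' : Measure Ω, IsProbabilityMeasure q' ∧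
      ∫ x, F x ∂(Kernel.trajMeasure (X := fun _ : ℕ => Ω) q
          (fun n : ℕ => (indepMH q w).comap (fun h : (i : ↥(Finset.Iic n)) → Ω => h ⟨n, Finset.mem_Iic.2 le_rfl⟩)
            (measurable_pi_apply _))) -
        ∫ x, F x ∂(Kernel.trajMeasure (X := fun _ : ℕ => Ω) (q.withDensity fun y => ENNReal.ofReal (w y))
          (fun n : ℕ => (indepMH q w).comap (fun h : (i : ↥(Finset.Iic n)) → Ω => h ⟨n, Finset.mem_Iic.2 le_rfl⟩)
            (measurable_pi_apply _))) =
      (1 - (w x₀)⁻¹) *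
        (∫ x, F x ∂(Kernel.trajMeasure (X := fun _ : ℕ => Ω) q'
          (fun n : ℕ => (indepMH q w).comap (fun h : (i : ↥(Finset.Iic n)) → Ω => h ⟨n, Finset.mem_Iic.2 le_rfl⟩)
            (measurable_pi_apply _))) -
        ∫ x, F x ∂(Kernel.trajMeasure (X := fun _ : ℕ => Ω) (q.withDensity fun y => ENNReal.ofReal (w y))
          (fun n : ℕ => (indepMH q w).comap (fun h : (i : ↥(Finset.Iic n)) → Ω => h ⟨n, Finset.mem_Iic.2 le_rfl⟩)
            (measurable_pi_apply _)))) := by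
  obtain ⟨q', hq', hmix⟩ := imh_chain_hotStart_exists_mixture (q := q) hw0 hmax
  refine ⟨q', hq', ?_⟩
  have hW : 1 ≤ w x₀ := one_le_of_mode (q := q) hmax
  have ha0 : 0 ≤ (w x₀)⁻¹ := inv_nonneg.mpr (hw0 x₀).le
  have hr0 : 0 ≤ 1 - (w x₀)⁻¹ := sub_nonneg.2 (inv_le_one_of_one_le₀ hW)
  rw [hmix, integral_add_measure ((integrable_of_bounded _ hF hC).smul_measure ENNReal.ofReal_ne_top)
      ((integrable_of_bounded _ hF hC).smul_measure ENNReal.ofReal_ne_top),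
    integral_smul_measure, integral_smul_measure, ENNReal.toReal_ofReal ha0, ENNReal.toReal_ofReal hr0,
    smul_eq_mul, smul_eq_mul]
  ring

/-! ## §2 The hot window-average bias keeps `S_N/N` and gains one factor `r` -/

/-- **THE HOT WINDOW-AVERAGE BIAS**: `E_q[A_{N,b}] − π f ∈ [(a − π f)·r^{b+1}·S_N/N, (c − π f)·r^{b+1}·S_N/N]` for
`a ≤ f ≤ c` measurable, every `b`, `N ≥ 1`. [ours] -/
theorem imh_chain_windowAverage_bias_hotStart_mem_Icc [Fact (Measurable w)] (hw0 : ∀ y, 0 < w y) {x₀ : Ω}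
    (hmax : ∀ y, w y ≤ w x₀) [IsProbabilityMeasure (q.withDensity fun y => ENNReal.ofReal (w y))]
    {f : Ω → ℝ} (hf : Measurable f) {a c : ℝ} (ha : ∀ x, a ≤ f x) (hc : ∀ x, f x ≤ c) (b : ℕ) {N : ℕ} (hN : N ≠ 0) :
    ∫ x, (∑ i ∈ range N, f (x (b + i))) / N ∂(Kernel.trajMeasure (X := fun _ : ℕ => Ω) q
        (fun n : ℕ => (indepMH q w).comap (fun h : (i : ↥(Finset.Iic n)) → Ω => h ⟨n, Finset.mem_Iic.2 le_rfl⟩)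
          (measurable_pi_apply _))) - ∫ x, f x ∂(q.withDensity fun y => ENNReal.ofReal (w y)) ∈
      Set.Icc ((a - ∫ x, f x ∂(q.withDensity fun y => ENNReal.ofReal (w y))) *
          ((1 - (w x₀)⁻¹) ^ (b + 1) * ∑ t ∈ range N, (1 - (w x₀)⁻¹) ^ t) / N)
        ((c - ∫ x, f x ∂(q.withDensity fun y => ENNReal.ofReal (w y))) *
          ((1 - (w x₀)⁻¹) ^ (b + 1) * ∑ t ∈ range N, (1 - (w x₀)⁻¹) ^ t) / N) := by
  set m := ∫ x, f x ∂(q.withDensity fun y => ENNReal.ofReal (w y)) with hm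
  have hC : ∀ x, |f x| ≤ max |a| |c| := fun x => abs_le_max_abs_abs (ha x) (hc x)
  have hAm : Measurable fun x : ℕ → Ω => (∑ i ∈ range N, f (x (b + i))) / N := measurable_windowAverage hf b N
  have hAC : ∀ x : ℕ → Ω, |(∑ i ∈ range N, f (x (b + i))) / N| ≤ max |a| |c| := fun x => by
    obtain ⟨h1, h2⟩ := timeAverage_mem_Icc ha hc hN x b
    exact abs_le_max_abs_abs h1 h2
  obtain ⟨q', hq', hsplit⟩ := imh_chain_integral_hotStart_eq (q := q) hw0 hmax hAm hAC (x₀ := x₀)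
  -- the equilibrium window average has mean `π f` (stationarity + `chain_mean_timeAverage`)
  have hst := imh_chain_stationary_shift_integral (q := q) hw0
    (F := fun x : ℕ → Ω => (∑ i ∈ range N, f (x i)) / N) (measurable_timeAverage hf N) b
  beta_reduce at hst
  rw [hst, chain_mean_timeAverage (κ := indepMH q w) (indepMH_invariant (q := q) Fact.out hw0) hf hC hN] at hsplit
  obtain ⟨h1, h2⟩ := imh_chain_windowAverage_bias_anyStart_mem_Icc (q := q) hw0 hmax q' hf ha hc b hN (x₀ := x₀)
  have hW : 1 ≤ w x₀ := one_le_of_mode (q := q) hmax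
  have hr0 : 0 ≤ 1 - (w x₀)⁻¹ := sub_nonneg.2 (inv_le_one_of_one_le₀ hW)
  have e : ∀ u : ℝ, (u - m) * ((1 - (w x₀)⁻¹) ^ (b + 1) * ∑ t ∈ range N, (1 - (w x₀)⁻¹) ^ t) / N =
      (1 - (w x₀)⁻¹) * ((u - m) * ((1 - (w x₀)⁻¹) ^ b * ∑ t ∈ range N, (1 - (w x₀)⁻¹) ^ t) / N) := fun u => by
    ring
  rw [Set.mem_Icc, e a, e c, hsplit]
  exact ⟨mul_le_mul_of_nonneg_left h1 hr0, mul_le_mul_of_nonneg_left h2 hr0⟩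

/-- **`|E_q[A_{N,b}] − π f| ≤ D·r^{b+1}·S_N/N`** and **`D·r^{b+1}·S_N/N ≤ D·r^{b+1}·min(1, w(x₀)/N)`**,
`D = max(π f − a, c − π f)`. [ours] -/
theorem imh_chain_windowAverage_bias_hotStart_abs_le [Fact (Measurable w)] (hw0 : ∀ y, 0 < w y) {x₀ : Ω}
    (hmax : ∀ y, w y ≤ w x₀) [IsProbabilityMeasure (q.withDensity fun y => ENNReal.ofReal (w y))]
    {f : Ω → ℝ} (hf : Measurable f) {a c : ℝ} (ha : ∀ x, a ≤ f x) (hc : ∀ x, f x ≤ c) (b : ℕ) {N : ℕ} (hN : N ≠ 0) :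
    |∫ x, (∑ i ∈ range N, f (x (b + i))) / N ∂(Kernel.trajMeasure (X := fun _ : ℕ => Ω) q
        (fun n : ℕ => (indepMH q w).comap (fun h : (i : ↥(Finset.Iic n)) → Ω => h ⟨n, Finset.mem_Iic.2 le_rfl⟩)
          (measurable_pi_apply _))) - ∫ x, f x ∂(q.withDensity fun y => ENNReal.ofReal (w y))| ≤
      max (∫ x, f x ∂(q.withDensity fun y => ENNReal.ofReal (w y)) - a)
          (c - ∫ x, f x ∂(q.withDensity fun y => ENNReal.ofReal (w y))) *
        ((1 - (w x₀)⁻¹) ^ (b + 1) * ∑ t ∈ range N, (1 - (w x₀)⁻¹) ^ t) / N ∧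
    max (∫ x, f x ∂(q.withDensity fun y => ENNReal.ofReal (w y)) - a)
          (c - ∫ x, f x ∂(q.withDensity fun y => ENNReal.ofReal (w y))) *
        ((1 - (w x₀)⁻¹) ^ (b + 1) * ∑ t ∈ range N, (1 - (w x₀)⁻¹) ^ t) / N ≤
      max (∫ x, f x ∂(q.withDensity fun y => ENNReal.ofReal (w y)) - a)
          (c - ∫ x, f x ∂(q.withDensity fun y => ENNReal.ofReal (w y))) *
        ((1 - (w x₀)⁻¹) ^ (b + 1) * min 1 (w x₀ / N)) := by
  obtain ⟨h1, h2⟩ := imh_chain_windowAverage_bias_hotStart_mem_Icc (q := q) hw0 hmax hf ha hc b hN (x₀ := x₀)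
  set m := ∫ x, f x ∂(q.withDensity fun y => ENNReal.ofReal (w y)) with hm
  set G := ((1 - (w x₀)⁻¹) ^ (b + 1) * ∑ t ∈ range N, (1 - (w x₀)⁻¹) ^ t) / N with hG
  have hNpos : (0 : ℝ) < N := by exact_mod_cast Nat.pos_of_ne_zero hN
  have hW : 1 ≤ w x₀ := one_le_of_mode (q := q) hmax
  have hr : 0 ≤ 1 - (w x₀)⁻¹ := sub_nonneg.2 (inv_le_one_of_one_le₀ hW)
  have hrb : 0 ≤ (1 - (w x₀)⁻¹) ^ (b + 1) := pow_nonneg hr _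
  have hS0 : 0 ≤ ∑ t ∈ range N, (1 - (w x₀)⁻¹) ^ t := sum_nonneg fun t _ => pow_nonneg hr t
  have hG0 : 0 ≤ G := div_nonneg (mul_nonneg hrb hS0) hNpos.le
  have hD0 : 0 ≤ max (m - a) (c - m) := by
    rcases le_total m a with h | h
    · exact le_max_of_le_right (by linarith [(ha x₀).trans (hc x₀)])
    · exact le_max_of_le_left (by linarith)
  have e1 : (a - m) * ((1 - (w x₀)⁻¹) ^ (b + 1) * ∑ t ∈ range N, (1 - (w x₀)⁻¹) ^ t) / N = (a - m) * G := by
    rw [hG]; ring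
  have e2 : (c - m) * ((1 - (w x₀)⁻¹) ^ (b + 1) * ∑ t ∈ range N, (1 - (w x₀)⁻¹) ^ t) / N = (c - m) * G := by
    rw [hG]; ring
  rw [e1] at h1
  rw [e2] at h2
  have hDa : m - a ≤ max (m - a) (c - m) := le_max_left _ _
  have hDc : c - m ≤ max (m - a) (c - m) := le_max_right _ _
  have hSN : (∑ t ∈ range N, (1 - (w x₀)⁻¹) ^ t) / N ≤ min 1 (w x₀ / N) := by
    refine le_min ?_ ?_
    · rw [div_le_one hNpos]; exact geom_sum_mode_le_card (q := q) hw0 hmax N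
    · exact div_le_div_of_nonneg_right (geom_sum_mode_le_weight (q := q) hw0 hmax N) hNpos.le
  refine ⟨?_, ?_⟩
  · rw [show max (m - a) (c - m) * ((1 - (w x₀)⁻¹) ^ (b + 1) * ∑ t ∈ range N, (1 - (w x₀)⁻¹) ^ t) / N =
      max (m - a) (c - m) * G by rw [hG]; ring, abs_le]
    constructor <;> nlinarith
  · rw [show max (m - a) (c - m) * ((1 - (w x₀)⁻¹) ^ (b + 1) * ∑ t ∈ range N, (1 - (w x₀)⁻¹) ^ t) / N =
      max (m - a) (c - m) * ((1 - (w x₀)⁻¹) ^ (b + 1) * ((∑ t ∈ range N, (1 - (w x₀)⁻¹) ^ t) / N)) by ring]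
    exact mul_le_mul_of_nonneg_left (mul_le_mul_of_nonneg_left hSN hrb) hD0

/-! ## §3 The hot mean-square error -/

/-- **THE HOT MEAN-SQUARE ERROR**: `E_q[(A_{N,b} − π f)²] − MSE_π(N) ∈ [−r^{b+1}·MSE_π(N), r^{b+1}·(D² − MSE_π(N))]`
(`N ≥ 1`). [ours] -/
theorem imh_chain_windowMSE_hotStart_mem_Icc [Fact (Measurable w)] (hw0 : ∀ y, 0 < w y) {x₀ : Ω}
    (hmax : ∀ y, w y ≤ w x₀) [IsProbabilityMeasure (q.withDensity fun y => ENNReal.ofReal (w y))]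
    {f : Ω → ℝ} (hf : Measurable f) {a c : ℝ} (ha : ∀ x, a ≤ f x) (hc : ∀ x, f x ≤ c) (b : ℕ) {N : ℕ} (hN : N ≠ 0) :
    ∫ x, ((∑ i ∈ range N, f (x (b + i))) / N - ∫ z, f z ∂(q.withDensity fun y => ENNReal.ofReal (w y))) ^ 2
        ∂(Kernel.trajMeasure (X := fun _ : ℕ => Ω) q
          (fun n : ℕ => (indepMH q w).comap (fun h : (i : ↥(Finset.Iic n)) → Ω => h ⟨n, Finset.mem_Iic.2 le_rfl⟩)
            (measurable_pi_apply _))) -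
      ∫ x, ((∑ i ∈ range N, f (x i)) / N - ∫ z, f z ∂(q.withDensity fun y => ENNReal.ofReal (w y))) ^ 2
        ∂(Kernel.trajMeasure (X := fun _ : ℕ => Ω) (q.withDensity fun y => ENNReal.ofReal (w y))
          (fun n : ℕ => (indepMH q w).comap (fun h : (i : ↥(Finset.Iic n)) → Ω => h ⟨n, Finset.mem_Iic.2 le_rfl⟩)
            (measurable_pi_apply _))) ∈
      Set.Icc
        (-((1 - (w x₀)⁻¹) ^ (b + 1) *
          ∫ x, ((∑ i ∈ range N, f (x i)) / N - ∫ z, f z ∂(q.withDensity fun y => ENNReal.ofReal (w y))) ^ 2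
            ∂(Kernel.trajMeasure (X := fun _ : ℕ => Ω) (q.withDensity fun y => ENNReal.ofReal (w y))
              (fun n : ℕ => (indepMH q w).comap (fun h : (i : ↥(Finset.Iic n)) → Ω => h ⟨n, Finset.mem_Iic.2 le_rfl⟩)
                (measurable_pi_apply _)))))
        ((1 - (w x₀)⁻¹) ^ (b + 1) *
          ((max (∫ z, f z ∂(q.withDensity fun y => ENNReal.ofReal (w y)) - a)
              (c - ∫ z, f z ∂(q.withDensity fun y => ENNReal.ofReal (w y)))) ^ 2 -
            ∫ x, ((∑ i ∈ range N, f (x i)) / N - ∫ z, f z ∂(q.withDensity fun y => ENNReal.ofReal (w y))) ^ 2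
              ∂(Kernel.trajMeasure (X := fun _ : ℕ => Ω) (q.withDensity fun y => ENNReal.ofReal (w y))
                (fun n : ℕ => (indepMH q w).comap (fun h : (i : ↥(Finset.Iic n)) → Ω => h ⟨n, Finset.mem_Iic.2 le_rfl⟩)
                  (measurable_pi_apply _))))) := by
  set m := ∫ z, f z ∂(q.withDensity fun y => ENNReal.ofReal (w y)) with hm
  obtain ⟨ν, hν, h⟩ := imh_chain_shift_hotStart_exists (q := q) hw0 hmax b (x₀ := x₀)
  set F : (ℕ → Ω) → ℝ := fun x => ((∑ i ∈ range N, f (x i)) / N - m) ^ 2 with hFdef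
  have hF : Measurable F := measurable_sq_timeAverage_sub hf m N
  have hFa : ∀ x, 0 ≤ F x := fun x => sq_nonneg _
  have hFc : ∀ x, F x ≤ (max (m - a) (c - m)) ^ 2 := fun x => by
    simpa [hFdef] using sq_timeAverage_sub_le ha hc m hN x 0
  have hC : ∀ x, |F x| ≤ max |(0 : ℝ)| |(max (m - a) (c - m)) ^ 2| := fun x => abs_le_max_abs_abs (hFa x) (hFc x)
  have hW : 1 ≤ w x₀ := one_le_of_mode (q := q) hmax
  have hr0 : 0 ≤ 1 - (w x₀)⁻¹ := sub_nonneg.2 (inv_le_one_of_one_le₀ hW)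
  have hr1 : 1 - (w x₀)⁻¹ ≤ 1 := sub_le_self _ (inv_nonneg.mpr (hw0 x₀).le)
  have hc0 : 0 ≤ 1 - (1 - (w x₀)⁻¹) ^ (b + 1) := sub_nonneg.2 (pow_le_one₀ hr0 hr1)
  have hΘ : Measurable (fun (x : ℕ → Ω) (n : ℕ) => x (b + n)) :=
    measurable_pi_lambda _ fun n => measurable_pi_apply _
  have key := integral_map (μ := Kernel.trajMeasure (X := fun _ : ℕ => Ω) q
      (fun n : ℕ => (indepMH q w).comap (fun h : (i : ↥(Finset.Iic n)) → Ω => h ⟨n, Finset.mem_Iic.2 le_rfl⟩)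
        (measurable_pi_apply _))) hΘ.aemeasurable (f := F) hF.aestronglyMeasurable
  rw [h, integral_add_measure ((integrable_of_bounded _ hF hC).smul_measure ENNReal.ofReal_ne_top)
      ((integrable_of_bounded _ hF hC).smul_measure ENNReal.ofReal_ne_top),
    integral_smul_measure, integral_smul_measure, ENNReal.toReal_ofReal hc0,
    ENNReal.toReal_ofReal (pow_nonneg hr0 (b + 1)), smul_eq_mul, smul_eq_mul] at key
  set Pπ := Kernel.trajMeasure (X := fun _ : ℕ => Ω) (q.withDensity fun y => ENNReal.ofReal (w y))
    (fun n : ℕ => (indepMH q w).comap (fun h : (i : ↥(Finset.Iic n)) → Ω => h ⟨n, Finset.mem_Iic.2 le_rfl⟩)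
      (measurable_pi_apply _)) with hPπ
  set Pν := Kernel.trajMeasure (X := fun _ : ℕ => Ω) ν
    (fun n : ℕ => (indepMH q w).comap (fun h : (i : ↥(Finset.Iic n)) → Ω => h ⟨n, Finset.mem_Iic.2 le_rfl⟩)
      (measurable_pi_apply _)) with hPν
  obtain ⟨hνa, hνc⟩ := integral_mem_Icc_of_bounds Pν hF hFa hFc
  have hgoal : ∫ x, ((∑ i ∈ range N, f (x (b + i))) / N - m) ^ 2 ∂(Kernel.trajMeasure (X := fun _ : ℕ => Ω) q
      (fun n : ℕ => (indepMH q w).comap (fun h : (i : ↥(Finset.Iic n)) → Ω => h ⟨n, Finset.mem_Iic.2 le_rfl⟩)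
        (measurable_pi_apply _))) = (1 - (1 - (w x₀)⁻¹) ^ (b + 1)) * ∫ x, F x ∂Pπ +
      (1 - (w x₀)⁻¹) ^ (b + 1) * ∫ x, F x ∂Pν := key.symm
  rw [hgoal, Set.mem_Icc]
  constructor <;> nlinarith [pow_nonneg hr0 (b + 1)]

/-- **`E_q[(A_{N,b} − π f)²] ≤ (2w(x₀) − 1)·Var_π f/N + r^{b+1}·D²`** (`N ≥ 1`). [ours] -/
theorem imh_chain_windowMSE_hotStart_le_explicit [Fact (Measurable w)] (hw0 : ∀ y, 0 < w y) {x₀ : Ω}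
    (hmax : ∀ y, w y ≤ w x₀) [IsProbabilityMeasure (q.withDensity fun y => ENNReal.ofReal (w y))]
    {f : Ω → ℝ} (hf : Measurable f) {a c : ℝ} (ha : ∀ x, a ≤ f x) (hc : ∀ x, f x ≤ c) (b : ℕ) {N : ℕ} (hN : N ≠ 0) :
    ∫ x, ((∑ i ∈ range N, f (x (b + i))) / N - ∫ z, f z ∂(q.withDensity fun y => ENNReal.ofReal (w y))) ^ 2
        ∂(Kernel.trajMeasure (X := fun _ : ℕ => Ω) q
          (fun n : ℕ => (indepMH q w).comap (fun h : (i : ↥(Finset.Iic n)) → Ω => h ⟨n, Finset.mem_Iic.2 le_rfl⟩)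
            (measurable_pi_apply _))) ≤
      (2 * w x₀ - 1) *
          (∫ x, (f x - ∫ z, f z ∂(q.withDensity fun y => ENNReal.ofReal (w y))) ^ 2
            ∂(q.withDensity fun y => ENNReal.ofReal (w y))) / N +
        (1 - (w x₀)⁻¹) ^ (b + 1) *
          (max (∫ z, f z ∂(q.withDensity fun y => ENNReal.ofReal (w y)) - a)
            (c - ∫ z, f z ∂(q.withDensity fun y => ENNReal.ofReal (w y)))) ^ 2 := by
  obtain ⟨-, h1⟩ := imh_chain_windowMSE_hotStart_mem_Icc (q := q) hw0 hmax hf ha hc b hN (x₀ := x₀)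
  have hC : ∀ x, |f x| ≤ max |a| |c| := fun x => abs_le_max_abs_abs (ha x) (hc x)
  have h2 := imh_chain_mse_stationary_le (q := q) hw0 hmax hf hC hN (x₀ := x₀)
  have h0 := imh_chain_windowMSE_anyStart_ge (q := q) hw0 hmax (q.withDensity fun y => ENNReal.ofReal (w y)) hf
    ha hc 0 hN (x₀ := x₀)
  simp only [pow_zero, sub_self, zero_mul, zero_add] at h0
  have hW : 1 ≤ w x₀ := one_le_of_mode (q := q) hmax
  have hr0 : 0 ≤ (1 - (w x₀)⁻¹) ^ (b + 1) := pow_nonneg (sub_nonneg.2 (inv_le_one_of_one_le₀ hW)) _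
  nlinarith

/-! ## §4 Hot-started replicas: every run from its own draw of the proposal -/

section Replicas

variable {Ω' : Type*} {mΩ' : MeasurableSpace Ω'} {μ : Measure Ω'} [IsProbabilityMeasure μ]
  {X : ℕ → Ω' → (ℕ → Ω)} {R : ℕ}

/-- **HOT-STARTED REPLICAS**: `R ≥ 1` pairwise independent runs, each distributed as the flow-MCMC chain started from
a draw of the proposal `q`, `b` discards, `N ≥ 1` kept:
`E(Ȳ − π f)² ≤ [(1 − r^{b+1})·MSE_π(N) + r^{b+1}·D²]/R + (1 − 1/R)·(D·r^{b+1}·S_N/N)²`. [ours] -/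
theorem imh_replicas_hotStart_mse_le [Fact (Measurable w)] (hw0 : ∀ y, 0 < w y) {x₀ : Ω}
    (hmax : ∀ y, w y ≤ w x₀) [IsProbabilityMeasure (q.withDensity fun y => ENNReal.ofReal (w y))]
    {f : Ω → ℝ} (hf : Measurable f) {a c : ℝ} (ha : ∀ x, a ≤ f x) (hc : ∀ x, f x ≤ c) (b : ℕ) {N : ℕ}
    (hN : N ≠ 0) (hR : R ≠ 0) (hXm : ∀ j, Measurable (X j))
    (hlaw : ∀ j < R, μ.map (X j) = Kernel.trajMeasure (X := fun _ : ℕ => Ω) q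
      (fun n : ℕ => (indepMH q w).comap (fun h : (i : ↥(Finset.Iic n)) → Ω => h ⟨n, Finset.mem_Iic.2 le_rfl⟩)
        (measurable_pi_apply _)))
    (hind : ∀ i < R, ∀ j < R, i ≠ j → IndepFun (X i) (X j) μ) :
    ∫ ω, (replicaMean (fun j ω => (∑ i ∈ range N, f (X j ω (b + i))) / N) R ω -
        ∫ z, f z ∂(q.withDensity fun y => ENNReal.ofReal (w y))) ^ 2 ∂μ ≤
      ((1 - (1 - (w x₀)⁻¹) ^ (b + 1)) *
            ∫ x, ((∑ i ∈ range N, f (x i)) / N - ∫ z, f z ∂(q.withDensity fun y => ENNReal.ofReal (w y))) ^ 2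
              ∂(Kernel.trajMeasure (X := fun _ : ℕ => Ω) (q.withDensity fun y => ENNReal.ofReal (w y))
                (fun n : ℕ => (indepMH q w).comap (fun h : (i : ↥(Finset.Iic n)) → Ω => h ⟨n, Finset.mem_Iic.2 le_rfl⟩)
                  (measurable_pi_apply _))) +
          (1 - (w x₀)⁻¹) ^ (b + 1) *
            (max (∫ z, f z ∂(q.withDensity fun y => ENNReal.ofReal (w y)) - a)
              (c - ∫ z, f z ∂(q.withDensity fun y => ENNReal.ofReal (w y)))) ^ 2) / R +
        (1 - 1 / R) *
          (max (∫ z, f z ∂(q.withDensity fun y => ENNReal.ofReal (w y)) - a)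
              (c - ∫ z, f z ∂(q.withDensity fun y => ENNReal.ofReal (w y))) *
            ((1 - (w x₀)⁻¹) ^ (b + 1) * ∑ t ∈ range N, (1 - (w x₀)⁻¹) ^ t) / N) ^ 2 := by
  set m := ∫ z, f z ∂(q.withDensity fun y => ENNReal.ofReal (w y)) with hm
  have hAm : Measurable fun x : ℕ → Ω => (∑ i ∈ range N, f (x (b + i))) / N := measurable_windowAverage hf b N
  have hY2 : ∀ j < R, MemLp (fun ω => (∑ i ∈ range N, f (X j ω (b + i))) / N) 2 μ :=
    fun j _ => memLp_replica_windowAverage hf ha hc b hN hXm j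
  have hb : ∀ j < R, |μ[fun ω => (∑ i ∈ range N, f (X j ω (b + i))) / N] - m| ≤
      max (m - a) (c - m) * ((1 - (w x₀)⁻¹) ^ (b + 1) * ∑ t ∈ range N, (1 - (w x₀)⁻¹) ^ t) / N := by
    intro j hj
    have h := integral_comp_eq_of_map_eq (hXm j) (hlaw j hj) hAm
    rw [show μ[fun ω => (∑ i ∈ range N, f (X j ω (b + i))) / N] =
        ∫ ω, (∑ i ∈ range N, f (X j ω (b + i))) / N ∂μ from rfl, h]
    exact (imh_chain_windowAverage_bias_hotStart_abs_le (q := q) hw0 hmax hf ha hc b hN (x₀ := x₀)).1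
  have hv : ∀ j < R, ∫ ω, ((∑ i ∈ range N, f (X j ω (b + i))) / N - m) ^ 2 ∂μ ≤
      (1 - (1 - (w x₀)⁻¹) ^ (b + 1)) *
          ∫ x, ((∑ i ∈ range N, f (x i)) / N - m) ^ 2
            ∂(Kernel.trajMeasure (X := fun _ : ℕ => Ω) (q.withDensity fun y => ENNReal.ofReal (w y))
              (fun n : ℕ => (indepMH q w).comap (fun h : (i : ↥(Finset.Iic n)) → Ω => h ⟨n, Finset.mem_Iic.2 le_rfl⟩)
                (measurable_pi_apply _))) +
        (1 - (w x₀)⁻¹) ^ (b + 1) * (max (m - a) (c - m)) ^ 2 := by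
    intro j hj
    have h := integral_comp_eq_of_map_eq (hXm j) (hlaw j hj)
      (φ := fun x : ℕ → Ω => ((∑ i ∈ range N, f (x (b + i))) / N - m) ^ 2) ((hAm.sub measurable_const).pow_const 2)
    rw [h]
    obtain ⟨-, h2⟩ := imh_chain_windowMSE_hotStart_mem_Icc (q := q) hw0 hmax hf ha hc b hN (x₀ := x₀)
    linarith
  have hcov : ∀ i < R, ∀ j < R, i ≠ j →
      cov[fun ω => (∑ k ∈ range N, f (X i ω (b + k))) / N, fun ω => (∑ k ∈ range N, f (X j ω (b + k))) / N; μ] = 0 :=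
    fun i hi j hj hij => ((hind i hi j hj hij).comp hAm hAm).covariance_eq_zero (hY2 i hi) (hY2 j hj)
  exact integral_replicaMean_sub_sq_le (Y := fun j ω => (∑ i ∈ range N, f (X j ω (b + i))) / N) hR hY2 hcov hb hv

/-- **Explicitly**: `E(Ȳ − π f)² ≤ [(2w(x₀) − 1)·Var_π f/N + r^{b+1}·D²]/R + (1 − 1/R)·(D·r^{b+1}·min(1, w(x₀)/N))²`
for hot-started pairwise independent runs (`N ≥ 1`, `R ≥ 1`). [ours] -/
theorem imh_replicas_hotStart_mse_le_explicit [Fact (Measurable w)] (hw0 : ∀ y, 0 < w y) {x₀ : Ω}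
    (hmax : ∀ y, w y ≤ w x₀) [IsProbabilityMeasure (q.withDensity fun y => ENNReal.ofReal (w y))]
    {f : Ω → ℝ} (hf : Measurable f) {a c : ℝ} (ha : ∀ x, a ≤ f x) (hc : ∀ x, f x ≤ c) (b : ℕ) {N : ℕ}
    (hN : N ≠ 0) (hR : R ≠ 0) (hXm : ∀ j, Measurable (X j))
    (hlaw : ∀ j < R, μ.map (X j) = Kernel.trajMeasure (X := fun _ : ℕ => Ω) q
      (fun n : ℕ => (indepMH q w).comap (fun h : (i : ↥(Finset.Iic n)) → Ω => h ⟨n, Finset.mem_Iic.2 le_rfl⟩)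
        (measurable_pi_apply _)))
    (hind : ∀ i < R, ∀ j < R, i ≠ j → IndepFun (X i) (X j) μ) :
    ∫ ω, (replicaMean (fun j ω => (∑ i ∈ range N, f (X j ω (b + i))) / N) R ω -
        ∫ z, f z ∂(q.withDensity fun y => ENNReal.ofReal (w y))) ^ 2 ∂μ ≤
      ((2 * w x₀ - 1) *
            (∫ x, (f x - ∫ z, f z ∂(q.withDensity fun y => ENNReal.ofReal (w y))) ^ 2
              ∂(q.withDensity fun y => ENNReal.ofReal (w y))) / N +
          (1 - (w x₀)⁻¹) ^ (b + 1) *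
            (max (∫ z, f z ∂(q.withDensity fun y => ENNReal.ofReal (w y)) - a)
              (c - ∫ z, f z ∂(q.withDensity fun y => ENNReal.ofReal (w y)))) ^ 2) / R +
        (1 - 1 / R) *
          (max (∫ z, f z ∂(q.withDensity fun y => ENNReal.ofReal (w y)) - a)
              (c - ∫ z, f z ∂(q.withDensity fun y => ENNReal.ofReal (w y))) *
            ((1 - (w x₀)⁻¹) ^ (b + 1) * min 1 (w x₀ / N))) ^ 2 := by
  have h1 := imh_replicas_hotStart_mse_le (q := q) hw0 hmax hf ha hc b hN hR hXm hlaw hind (x₀ := x₀)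
  set m := ∫ z, f z ∂(q.withDensity fun y => ENNReal.ofReal (w y)) with hm
  have hC : ∀ x, |f x| ≤ max |a| |c| := fun x => abs_le_max_abs_abs (ha x) (hc x)
  have h2 := imh_chain_mse_stationary_le (q := q) hw0 hmax hf hC hN (x₀ := x₀)
  have hM0 := imh_chain_windowMSE_anyStart_ge (q := q) hw0 hmax (q.withDensity fun y => ENNReal.ofReal (w y)) hf
    ha hc 0 hN (x₀ := x₀)
  simp only [pow_zero, sub_self, zero_mul, zero_add] at hM0
  have hRpos : (0 : ℝ) < R := by exact_mod_cast Nat.pos_of_ne_zero hR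
  have hW : 1 ≤ w x₀ := one_le_of_mode (q := q) hmax
  have hr : 0 ≤ 1 - (w x₀)⁻¹ := sub_nonneg.2 (inv_le_one_of_one_le₀ hW)
  have hr1 : 1 - (w x₀)⁻¹ ≤ 1 := sub_le_self _ (inv_nonneg.mpr (hw0 x₀).le)
  have hrb : 0 ≤ (1 - (w x₀)⁻¹) ^ (b + 1) := pow_nonneg hr _
  have hc1 : 1 - (1 - (w x₀)⁻¹) ^ (b + 1) ≤ 1 := sub_le_self _ hrb
  have hR1 : 0 ≤ 1 - 1 / (R : ℝ) := by
    rw [sub_nonneg, div_le_one hRpos]; exact_mod_cast Nat.one_le_iff_ne_zero.2 hR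
  obtain ⟨hbias, hmin⟩ := imh_chain_windowAverage_bias_hotStart_abs_le (q := q) hw0 hmax hf ha hc b hN (x₀ := x₀)
  have hb0 : 0 ≤ max (m - a) (c - m) * ((1 - (w x₀)⁻¹) ^ (b + 1) * ∑ t ∈ range N, (1 - (w x₀)⁻¹) ^ t) / N :=
    (abs_nonneg _).trans hbias
  have hsq := mul_le_mul_of_nonneg_left (pow_le_pow_left₀ hb0 hmin 2) hR1
  have hvar : (1 - (1 - (w x₀)⁻¹) ^ (b + 1)) *
      ∫ x, ((∑ i ∈ range N, f (x i)) / N - m) ^ 2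
        ∂(Kernel.trajMeasure (X := fun _ : ℕ => Ω) (q.withDensity fun y => ENNReal.ofReal (w y))
          (fun n : ℕ => (indepMH q w).comap (fun h : (i : ↥(Finset.Iic n)) → Ω => h ⟨n, Finset.mem_Iic.2 le_rfl⟩)
            (measurable_pi_apply _))) ≤
      (2 * w x₀ - 1) * (∫ x, (f x - m) ^ 2 ∂(q.withDensity fun y => ENNReal.ofReal (w y))) / N :=
    (mul_le_of_le_one_left hM0 hc1).trans h2
  have hdiv := div_le_div_of_nonneg_right
    (add_le_add hvar (le_refl ((1 - (w x₀)⁻¹) ^ (b + 1) * (max (m - a) (c - m)) ^ 2))) hRpos.le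
  linarith

end Replicas

end Summit.Ventures.LatticeQCDFlow.Exactness
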